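import Summits.PneNP.PneNP.Theorems.ExpanderLinearGeneratorsLinearGeneratorModPFregeHardDepthDecay
import Literature.Computability.MetaComplexity.GaussianWidth
import HarnessLib

/-!
# The exponent of `GaussianWidthDepthFregeLB` must decay with the depth (calibration of
stmt-PneNP-11425: its uniform-in-depth strengthening is FALSE)

Route `PneNP/MatroidTseitin`, crux `GaussianWidthDepthFregeLB` (stmt-PneNP-11425): "for every row
width `ℓ` and depth `d` there are `ε > 0` and `N` such that every `ℓ`-sparse system of Gaussian
width `≥ w ≥ N` needs depth-`d` `textbookFrege` refutations of size `≥ 2^{w^ε}`". The item's own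
"why it might fail" names "non-linear divide-and-conquer" refutations; the tree now has them
(`Literature.Computability.MetaComplexity.depthFrege_gaussianElimination`: depth `2D + 19`, size
`2^{O(D n^{1/D} + ℓ + log m)}` for EVERY unsolvable `ℓ`-sparse system), and this file records what
they say about the crux: nothing against it as stated (`ε` is chosen after `d`), but

* `gaussianWidthLB_eps_le_inv` — for `ℓ ≥ 9` and `D ≥ 1`, every exponent `ε` admissible at depth
  `2D + 19` satisfies `ε ≤ 1/D` (tested on the `(n^{1-δ}, 3ℓ/4)`-boundary expanders of
  `linearGeneratorDepthFregeHard_instances`, whose Gaussian width is `≥ n^{1-δ}` by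
  `le_gaussianWidth_of_isBoundaryExpander`, for `δ` small);
* `not_uniform_gaussianWidthDepthFregeLB` — hence the strengthening with `∃ ε` before `∀ d` is
  FALSE for every `ℓ ≥ 9`: the conjecture can only hold in the Håstad / GIRS shape `2^{w^{Θ(1/d)}}`.

Sources: J. Håstad, J. ACM 68 (2021); N. Galesi et al., APAL 174 (2023), Thm. 1; E. Ben-Sasson,
R. Impagliazzo, Comput. Complexity 19 (2010) (Gaussian width).
-/

set_option linter.dupNamespace false -- `Summit.PneNP.PneNP.…`: summit = sub-problem (D-0017)

namespace Summit.PneNP.PneNP.Theorems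

open Literature.Computability.Complexity Literature.Computability.Complexity.PropForm
open Literature.Computability.MetaComplexity Filter Topology

/-- **The exponent of `GaussianWidthDepthFregeLB` at depth `2D + 19` is at most `1/D`** (`ℓ ≥ 9`):
if every `ℓ`-sparse system over `𝔽₂` of Gaussian width `≥ w ≥ N` (in the route's inlined form:
every symmetric-difference derivation of an odd empty row sum passes through a row sum with `≥ w`
variables) needs depth-`(2D+19)` `textbookFrege` refutations of size `≥ 2^{w^ε}`, then `ε ≤ 1/D`.
[cite: GalesiEtAl2023, Thm. 1 (upper bound)] -/
theorem gaussianWidthLB_eps_le_inv {ℓ : ℕ} (hℓ : 9 ≤ ℓ) (D : ℕ) (hD1 : 1 ≤ D) {ε : ℝ} (hε : 0 < ε)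
    (h : ∃ N : ℕ, ∀ (m n w : ℕ) (E : Fin m → LinEqMod 2 n), (∀ e, (E e).supp.card ≤ ℓ) → N ≤ w →
      (∀ (t : ℕ) (S : Fin (t + 1) → Finset (Fin m)),
        (∀ i, (∃ e, S i = {e}) ∨ (∃ j k, j < i ∧ k < i ∧ S i = symmDiff (S j) (S k))) →
        (lincomb (fun e => if e ∈ S (Fin.last t) then (1 : ZMod 2) else 0) E).1 = 0 →
        (lincomb (fun e => if e ∈ S (Fin.last t) then (1 : ZMod 2) else 0) E).2 = 1 →
        ∃ i, w ≤ (lincomb (fun e => if e ∈ S i then (1 : ZMod 2) else 0) E).supp.card) →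
      ∀ π : List (PropForm ℕ),
        textbookFrege.IsDepthProofOf (2 * D + 19) π (neg (PropForm.ofCNF (sumEncoding 1 E))) →
        (2 : ℝ) ^ ((w : ℝ) ^ ε) ≤ (proofSize π : ℝ)) :
    ε ≤ 1 / (D : ℝ) := by
  by_contra hDε
  push Not at hDε
  have hD0 : (0 : ℝ) < D := by exact_mod_cast hD1
  -- an exponent `1 - δ` close to `1` with `(1 - δ) ε > 1/D`
  set δ : ℝ := (ε - 1 / (D : ℝ)) / (2 * ε) with hδ
  have hδ0 : 0 < δ := by rw [hδ]; exact div_pos (by linarith) (by linarith)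
  have hδ1 : δ < 1 := by
    rw [hδ, div_lt_one (by linarith)]
    have : 0 < 1 / (D : ℝ) := by positivity
    linarith
  set η : ℝ := (1 - δ) * ε with hη
  have hηε : η = (ε + 1 / (D : ℝ)) / 2 := by rw [hη, hδ]; field_simp; ring
  have hDη : 1 / (D : ℝ) < η := by rw [hηε]; linarith
  obtain ⟨N, hN⟩ := h
  obtain ⟨N₀, hN₀⟩ := linearGeneratorDepthFregeHard_instances hℓ hδ0
  have h2ε : (0 : ℝ) < (2 : ℝ) ^ ε := by positivity
  obtain ⟨N₁, hN₁⟩ := eventually_lt_rpow hD1 hDη (A := 110 * (2 : ℝ) ^ ε)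
    (220 * ((D : ℝ) + 1) * (2 : ℝ) ^ ε) (110 * (3 * ((D : ℝ) + 1) + ℓ) * (2 : ℝ) ^ ε) (by positivity)
  -- `n^{1-δ}` eventually exceeds `N + 2`
  obtain ⟨N₂, hN₂⟩ : ∃ N₂ : ℕ, ∀ n : ℕ, N₂ ≤ n → ((N : ℝ) + 2) ≤ (n : ℝ) ^ (1 - δ) := by
    have hT : Tendsto (fun n : ℕ => (n : ℝ) ^ (1 - δ)) atTop atTop :=
      (tendsto_rpow_atTop (by linarith)).comp tendsto_natCast_atTop_atTop
    exact eventually_atTop.1 (hT.eventually_ge_atTop _)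
  -- a large `n`, an instance, its Gaussian width, its short refutation
  set n := max N₀ (max N₁ N₂) with hn
  have hn0 : N₀ ≤ n := le_max_left _ _
  have hnN₁ : N₁ ≤ n := (le_max_left _ _).trans (le_max_right _ _)
  have hnN₂ : N₂ ≤ n := (le_max_right _ _).trans (le_max_right _ _)
  obtain ⟨m, hm, E, hEℓ, hexp, hunsat⟩ := hN₀ n hn0
  set r : ℝ := (n : ℝ) ^ (1 - δ) with hr
  have hrN : (N : ℝ) + 2 ≤ r := hN₂ n hnN₂
  have hr1 : 1 ≤ r := by linarith [show (0 : ℝ) ≤ N from Nat.cast_nonneg N]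
  have hr0 : 0 ≤ r := by linarith
  set w : ℕ := ⌊r⌋₊ with hw
  have hwr : (w : ℝ) ≤ r := Nat.floor_le hr0
  have hrw : r < w + 1 := Nat.lt_floor_add_one r
  have hNw : N ≤ w := by
    have : (N : ℝ) < (w : ℝ) + 1 - 1 := by linarith
    exact_mod_cast (by linarith : (N : ℝ) ≤ w)
  have hℓpos : (0 : ℝ) < 3 / 4 * (ℓ : ℝ) := by positivity
  have hwc : (w : ℝ) ≤ 3 / 4 * (ℓ : ℝ) * r / 2 := by
    have h9 : (9 : ℝ) ≤ ℓ := by exact_mod_cast hℓ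
    nlinarith
  have hgw := (le_gaussianWidth_iff E w).1 (le_gaussianWidth_of_isBoundaryExpander E hℓpos hr1 hexp hwc)
  obtain ⟨π, hπ, hsize⟩ := exists_depthProof_rpow D hD1 E hEℓ hunsat
  have hlow := hN m n w E hEℓ hNw hgw π hπ
  have hlt := hN₁ n hnN₁
  -- `size ≤ 2^{f n}`
  set f : ℝ := 110 * Real.logb 2 ((n : ℝ) + 2) + 220 * ((D : ℝ) + 1) * ((n : ℝ) ^ (1 / (D : ℝ)) + 1) +
    110 * (3 * ((D : ℝ) + 1) + ℓ) with hf
  have hm2 : (0 : ℝ) < (m : ℝ) + 2 := by positivity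
  have hpow : ((m : ℝ) + 2) ^ 110 ≤ (2 : ℝ) ^ (110 * Real.logb 2 ((n : ℝ) + 2)) := by
    have e : ((m : ℝ) + 2) ^ 110 = (2 : ℝ) ^ (110 * Real.logb 2 ((m : ℝ) + 2)) := by
      rw [mul_comm, Real.rpow_mul (by norm_num), Real.rpow_logb (by norm_num) (by norm_num) hm2]
      norm_cast
    rw [e]
    refine Real.rpow_le_rpow_of_exponent_le (by norm_num) (mul_le_mul_of_nonneg_left ?_ (by norm_num))
    exact Real.logb_le_logb_of_le (by norm_num) hm2
      (by linarith [show (m : ℝ) ≤ n from by exact_mod_cast hm])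
  have hsize' : (proofSize π : ℝ) ≤ (2 : ℝ) ^ f := by
    refine hsize.trans ?_
    rw [hf, show 110 * Real.logb 2 ((n : ℝ) + 2) + 220 * ((D : ℝ) + 1) * ((n : ℝ) ^ (1 / (D : ℝ)) + 1) +
        110 * (3 * ((D : ℝ) + 1) + ℓ) = 110 * Real.logb 2 ((n : ℝ) + 2) +
        110 * (((D : ℝ) + 1) * (2 * ((n : ℝ) ^ (1 / (D : ℝ)) + 1) + 3) + ℓ) by ring,
      Real.rpow_add (by norm_num)]
    exact mul_le_mul_of_nonneg_right hpow (by positivity)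
  have hchain : (2 : ℝ) ^ ((w : ℝ) ^ ε) ≤ (2 : ℝ) ^ f := hlow.trans hsize'
  rw [Real.rpow_le_rpow_left_iff one_lt_two] at hchain
  -- `w ≥ r / 2`, so `w^ε ≥ r^ε / 2^ε = n^η / 2^ε > f`
  have hw2 : r / 2 ≤ w := by linarith
  have hwε : (r / 2) ^ ε ≤ (w : ℝ) ^ ε := Real.rpow_le_rpow (by linarith) hw2 hε.le
  have hrε : (r / 2) ^ ε = (n : ℝ) ^ η / (2 : ℝ) ^ ε := by
    rw [Real.div_rpow hr0 (by norm_num), hr, ← Real.rpow_mul (Nat.cast_nonneg n), hη]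
  have hf2 : f * (2 : ℝ) ^ ε < (n : ℝ) ^ η := by
    have e : (110 * (2 : ℝ) ^ ε) * Real.logb 2 ((n : ℝ) + 2) +
        220 * ((D : ℝ) + 1) * (2 : ℝ) ^ ε * ((n : ℝ) ^ (1 / (D : ℝ)) + 1) +
        110 * (3 * ((D : ℝ) + 1) + ℓ) * (2 : ℝ) ^ ε = f * (2 : ℝ) ^ ε := by rw [hf]; ring
    linarith [hlt, e.symm.le, e.le]
  have hf3 : f < (n : ℝ) ^ η / (2 : ℝ) ^ ε := by rw [lt_div_iff₀ h2ε]; exact hf2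
  linarith [hwε, hrε.symm.le, hrε.le]

/-- **`GaussianWidthDepthFregeLB` with `∃ ε` before `∀ d` is false** (every `ℓ ≥ 9`): no single
`ε > 0` serves all depths, since at depth `2D + 19` only `ε ≤ 1/D` is admissible. The conjecture can
only hold with an exponent decaying with the depth. [cite: GalesiEtAl2023, Thm. 1 (upper bound)] -/
theorem not_uniform_gaussianWidthDepthFregeLB {ℓ : ℕ} (hℓ : 9 ≤ ℓ) :
    ¬ ∃ ε : ℝ, 0 < ε ∧ ∀ d : ℕ, ∃ N : ℕ, ∀ (m n w : ℕ) (E : Fin m → LinEqMod 2 n),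
      (∀ e, (E e).supp.card ≤ ℓ) → N ≤ w →
      (∀ (t : ℕ) (S : Fin (t + 1) → Finset (Fin m)),
        (∀ i, (∃ e, S i = {e}) ∨ (∃ j k, j < i ∧ k < i ∧ S i = symmDiff (S j) (S k))) →
        (lincomb (fun e => if e ∈ S (Fin.last t) then (1 : ZMod 2) else 0) E).1 = 0 →
        (lincomb (fun e => if e ∈ S (Fin.last t) then (1 : ZMod 2) else 0) E).2 = 1 →
        ∃ i, w ≤ (lincomb (fun e => if e ∈ S i then (1 : ZMod 2) else 0) E).supp.card) →
      ∀ π : List (PropForm ℕ),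
        textbookFrege.IsDepthProofOf d π (neg (PropForm.ofCNF (sumEncoding 1 E))) →
        (2 : ℝ) ^ ((w : ℝ) ^ ε) ≤ (proofSize π : ℝ) := by
  rintro ⟨ε, hε, h⟩
  set D : ℕ := ⌈1 / ε⌉₊ + 1 with hD
  have hD1 : 1 ≤ D := by omega
  have hDε : 1 / (D : ℝ) < ε := by
    have h1 : 1 / ε < (D : ℝ) := by
      rw [hD]; push_cast; exact (Nat.le_ceil _).trans_lt (lt_add_one _)
    have hpos : (0 : ℝ) < D := by positivity
    rw [div_lt_iff₀ hpos]
    rw [div_lt_iff₀ hε] at h1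
    linarith
  have hle := gaussianWidthLB_eps_le_inv hℓ D hD1 hε (h (2 * D + 19))
  linarith

end Summit.PneNP.PneNP.Theorems
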